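import Summits.ABC.ABC.Theses.DefiniteXi
import Summits.ABC.ABC.Theorems.DefiniteXiDefiniteRTControlPrimeOfTakahashi
import Summits.ABC.ABC.Theorems.DefiniteXiDefiniteRTControlPrimeTwoFacts
import Literature.NumberTheory.EllipticCurves.PastenHeightBoundsLemma68LocalProofs
import Literature.NumberTheory.EllipticCurves.RationalIsogenyDegreesProofs
import HarnessLib

/-!
# STUB-PLAN certificate — `stub_pastenLemma68 : PastenShimura2024_lemma_6_8` (crux stmt-ABC-11338)

Stub-critic scratch check (planner, mode stub-critic).  Every claim the STUB-PLAN relies on is a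
named theorem below; `lean check` rc 0 with 0 sorries certifies them all at once.
-/

set_option linter.dupNamespace false

namespace Summit.ABC.ABC.Cruxes.DefiniteRTControlPrime.StubPlanPastenLemma68

open Summit.ABC.ABC.Theses.DefiniteXi
open Literature.NumberTheory.EllipticCurves Literature.NumberTheory.EllipticCurves.ModularForms
open WeierstrassCurve

/-- C1. The stub IS route item stmt-ABC-18928 (`IsogenyValuationTransport`), definitionally. -/
theorem stub_iff_item : PastenShimura2024_lemma_6_8 ↔ IsogenyValuationTransport := Iff.rfl

/-- C2. Closer from the Literature named fact (tree one-liner). -/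
theorem stub_of_mazurKenku (hMK : mazurKenku_exists_cyclic_isogeny) :
    PastenShimura2024_lemma_6_8 :=
  PastenShimura2024_lemma_6_8_of_mazurKenku' hMK

/-- C3. Closer from the route's radius item stmt-ABC-15193 (`MazurKenkuRadius`): cyclic factor of a
degree-`≤ 163` isogeny + the Mazur-free cyclic transport. -/
theorem stub_of_radius (hR : MazurKenkuRadius) : PastenShimura2024_lemma_6_8 := by
  intro W W' _ _ hiso v hv
  have hv' : W'.HasMultiplicativeReductionAt v := hasMultiplicativeReductionAt_of_isIsogenous hiso v hv
  obtain ⟨φ, hφ⟩ := hR W W' hiso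
  obtain ⟨ψ, hψ, hdvd⟩ := φ.exists_isCyclic_degree_dvd
  have hψB : ψ.degree ≤ 163 := (Nat.le_of_dvd φ.degree_pos hdvd).trans hφ
  obtain ⟨a, b, ha, hb, hab, h⟩ :=
    exists_ordMinimalDiscriminant_mul_eq_mul_of_isCyclic ψ.degree ψ hψ rfl v hv hv'
  have habn : a * b ≤ ψ.degree := Nat.le_of_dvd ψ.degree_pos hab
  refine ⟨a, b, ha, ?_, hb, ?_, h⟩
  · have : a ≤ a * b := Nat.le_mul_of_pos_right a hb
    omega
  · have : b ≤ a * b := Nat.le_mul_of_pos_left b ha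
    omega

/-- C4. DEPTH certificate (why no Mazur-free proof of the verbatim stub exists): the stub implies
Mazur's bound `ℓ ≤ 163` for prime-degree `ℚ`-isogenies out of any curve with a multiplicative place
(tree `prime_degree_le_163_of_PastenShimura2024_lemma_6_8`). -/
theorem mazurBound_of_stub (h68 : PastenShimura2024_lemma_6_8)
    {W W' : WeierstrassCurve ℚ} [W.IsElliptic] [W'.IsElliptic] (φ : Isogeny W W') {ℓ : ℕ}
    (hℓ : ℓ.Prime) (hdeg : φ.degree = ℓ) (v : IsDedekindDomain.HeightOneSpectrum ℤ)
    (hv : W.HasMultiplicativeReductionAt v) : ℓ ≤ 163 :=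
  prime_degree_le_163_of_PastenShimura2024_lemma_6_8 h68 φ hℓ hdeg v hv

/-- C5. The stub is MOOT for the crux: the crux from `stub_takahashi` ALONE (landed p839521). -/
theorem crux_of_takahashi_alone (hT : takahashi2001_thm_2_3_of_coprime) : DefiniteRTControlPrime :=
  Summit.ABC.ABC.Theorems.DefiniteRTControlPrime.definiteRTControlPrime_of_takahashi hT

/-- C6. Fallback composition without this stub: the crux from the two other stubs (landed p838145). -/
theorem crux_of_two_facts (hT : takahashi2001_thm_2_3_of_coprime)
    (h163 : PastenShimura2024_minimalDegree_le_163_mul) : DefiniteRTControlPrime :=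
  Summit.ABC.ABC.Theorems.DefiniteRTControlPrime.definiteRTControlPrime_of_two_facts hT h163

end Summit.ABC.ABC.Cruxes.DefiniteRTControlPrime.StubPlanPastenLemma68
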